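import Summits.QuantumAdvantage.QuantumAdvantage.Theorems.CubicForrelationSignedExactCubicForrelationNotPrBPPStubNoTrapTemplate
import Summits.QuantumAdvantage.QuantumAdvantage.Theorems.CubicForrelationSignedExactCubicForrelationNotPrBPPStubNoTrapTransport

/-!
# Crux `CubicForrelation.SignedExactCubicForrelationNotPrBPP` (stmt-QuantumAdvantage-13932), line `dual-pingpong-frame`
# (GROW reshape): the kernel statistics hold TRIVIALLY below `m = 23`

Support file (`--supports stmt-QuantumAdvantage-13932`). The one open stub of the line, `stub_kernelStats`
(`Grow.KernelStats`), asks at every closed orthogonal non-terminal pair `(S, U)` for a number of probes `r ≤ n + 1`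
whose candidate spaces carry a NEW GOOD vector with density `≥ (n+2)⁻⁸`. This file records that the statement has
no finite content below `n = 46`: with ZERO probes the candidate space is `K(∅) = Z_b(S) ∩ U^⊥`, which contains the
no-trap extension `V* ⊋ S` of the pair (landed `stub_noTrapTemplate` / `stub_noTrapTransport`: every closed
orthogonal pair of a Maiorana–McFarland-orbit exact cubic pair extends to an M-subspace `V* ⊇ S`, `V* ⊥ U`; and
`V* ⊆ Z_b(S)` because `V*` is `b`-flat), so the good density at `r = 0` is at least `1/|K(∅)| ≥ 2^{-2m}`, and
`2^{-2m} ≥ (2m+2)^{-8}` exactly when `m ≤ 22`. Consequently every counterexample to the registered stub — and every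
meaningful numerical test of it — lives at `m ≥ 23` (`n ≥ 46`): the stub is an ASYMPTOTIC statement about families of
biquadratic permutations (lead c3 notes, 2026-08-16).

* `one_div_le_card_filter_div_card` — counting core: a witnessed sub-filter of a finset `K` of a finite type of size
  `≤ B` has relative size `≥ 1/B`;
* `kernelStats_of_le_twentytwo` — verbatim the registered statement of `stub_kernelStats` with the extra hypothesis
  `m ≤ 22` (the `b`-side disjunct, witnessed by `r = 0`).

References: C. Carlet, *Boolean Functions for Cryptography and Coding Theory*, CUP 2021, Prop. 54 (Dillon's
criterion, M-subspaces of the completed Maiorana–McFarland class) [Carlet2020]; S. Arora, B. Barak,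
*Computational Complexity: A Modern Approach*, CUP 2009, §7.1 (success probabilities) [AroraBarak2009]. -/

noncomputable section

set_option linter.dupNamespace false -- D-0017: single-problem summit ⇒ `QuantumAdvantage.QuantumAdvantage` by design

namespace Summit.QuantumAdvantage.QuantumAdvantage.Theorems.SignedExactCubicForrelationNotPrBPP

open Finset
open Literature.Computability.Complexity Literature.Computability.QuantumComplexity
open Literature.Computability.QuantumComplexity.BuzetChailloux (bxor zeroVec)

/-- Numerical core: `2^{2m} ≤ (2m+2)^8` for `m ≤ 22` (it fails from `m = 23` on). [folklore] -/
theorem two_pow_two_mul_le_pow_eight {m : ℕ} (hm : m ≤ 22) : (2 : ℝ) ^ (m + m) ≤ ((m : ℝ) + m + 2) ^ 8 := by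
  have h : 2 ^ (m + m) ≤ (m + m + 2) ^ 8 := by interval_cases m <;> norm_num
  exact_mod_cast h

/-- Counting core: if `v ∈ K` satisfies `p`, the `p`-part of `K` has relative size `≥ 1/B` for any bound `B` on the
size of the ambient finite type (the filter is taken with an explicitly supplied decidability instance, as in the
registered statement). [cite: AroraBarak2009, §7.1] -/
theorem one_div_le_card_filter_div_card {α : Type*} [Fintype α] (p : α → Prop) (inst : DecidablePred p)
    (K : Finset α) (v : α) (hvK : v ∈ K) (hpv : p v) (B : ℝ) (hB : (Fintype.card α : ℝ) ≤ B) :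
    1 / B ≤ ((@Finset.filter α p inst K).card : ℝ) / (K.card : ℝ) := by
  have hK : (K.card : ℝ) ≤ B := le_trans (by exact_mod_cast Finset.card_le_univ K) hB
  have hKpos : (0 : ℝ) < K.card := by exact_mod_cast Finset.card_pos.2 ⟨v, hvK⟩
  have hG : (1 : ℝ) ≤ ((@Finset.filter α p inst K).card : ℝ) := by
    have : 0 < (@Finset.filter α p inst K).card := Finset.card_pos.2 ⟨v, (@Finset.mem_filter α p inst K v).2 ⟨hvK, hpv⟩⟩
    exact_mod_cast this
  calc 1 / B ≤ 1 / (K.card : ℝ) := one_div_le_one_div_of_le hKpos hK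
    _ ≤ ((@Finset.filter α p inst K).card : ℝ) / (K.card : ℝ) := by gcongr

/-- **The kernel statistics below `m = 23` (verbatim `stub_kernelStats` with the extra hypothesis `m ≤ 22`).**
At `r = 0` the candidate space `K(∅) = Z_b(S) ∩ U^⊥` contains the no-trap extension `V* ⊋ S` of the closed orthogonal
pair (landed `stub_noTrapTransport stub_noTrapTemplate`), hence a new good vector; and `|K(∅)| ≤ 2^{2m} ≤ (2m+2)^8`.
[cite: Carlet2020, Prop. 54] -/
theorem kernelStats_of_le_twentytwo :
    ∀ (m : ℕ), m ≤ 22 → ∀ (C : Fin 2 → Circuit (Fin (m + m))),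
        (⟨m + m, 2, C⟩ : KForrelationInstance).IsOverB2 →
        (∀ i, IsDegLeFun 3 (C i).eval) →
        (forrelation (C 0).eval (C 1).eval = 1 ∨ forrelation (C 0).eval (C 1).eval = -1) →
        (∃ e : (Fin (m + m) → Bool) ≃ (Fin (m + m) → Bool),
          (∃ M : Matrix (Fin (m + m)) (Fin (m + m)) (ZMod 2), ∃ c : Fin (m + m) → ZMod 2,
            ∀ y i, (if e y i then (1 : ZMod 2) else 0) = (M.mulVec (fun j => if y j then (1 : ZMod 2) else 0) + c) i) ∧
          ∃ perm : (Fin m → Bool) ≃ (Fin m → Bool), ∃ h : (Fin m → Bool) → Bool, ∀ y' y'' : Fin m → Bool,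
            (if (C 1).eval (e (Fin.append y' y'')) then (1 : ZMod 2) else 0) =
              (∑ i, (if y' i then (1 : ZMod 2) else 0) * (if perm y'' i then (1 : ZMod 2) else 0)) +
                (if h y'' then (1 : ZMod 2) else 0)) →
        ∀ S U : Finset (Fin (m + m) → Bool),
          (zeroVec ∈ S ∧ ∀ x ∈ S, ∀ y ∈ S, bxor x y ∈ S) → (zeroVec ∈ U ∧ ∀ x ∈ U, ∀ y ∈ U, bxor x y ∈ U) →
          ((∀ s ∈ S, ∀ y : Fin (m + m) → Bool, (fun k => ((C 1).eval zeroVec ^^ (C 1).eval (bxor zeroVec s) ^^ (C 1).eval (bxor zeroVec y) ^^ (C 1).eval (bxor zeroVec (bxor s y))) ^^ ((C 1).eval (fun j => decide (j = k)) ^^ (C 1).eval (bxor (fun j => decide (j = k)) s) ^^ (C 1).eval (bxor (fun j => decide (j = k)) y) ^^ (C 1).eval (bxor (fun j => decide (j = k)) (bxor s y)))) ∈ U) ∧ (∀ s ∈ S, ∃ ℓ ∈ U, ∀ r : Fin (m + m) → Bool, (∀ y z : Fin (m + m) → Bool, (((C 1).eval z ^^ (C 1).eval (bxor z s) ^^ (C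 1).eval (bxor z r) ^^ (C 1).eval (bxor z (bxor s r))) ^^ ((C 1).eval (bxor z y) ^^ (C 1).eval (bxor (bxor z y) s) ^^ (C 1).eval (bxor (bxor z y) r) ^^ (C 1).eval (bxor (bxor z y) (bxor s r)))) = false) → ((C 1).eval r ^^ (C 1).eval (bxor r s) ^^ (C 1).eval zeroVec ^^ (C 1).eval s) = ((Finset.univ.filter fun i => ℓ i && r i).card).bodd)) →
          ((∀ s ∈ U, ∀ y : Fin (m + m) → Bool, (fun k => ((C 0).eval zeroVec ^^ (C 0).eval (bxor zeroVec s) ^^ (C 0).eval (bxor zeroVec y) ^^ (C 0).eval (bxor zeroVec (bxor s y))) ^^ ((C 0).eval (fun j => decide (j = k)) ^^ (C 0).eval (bxor (fun j => decide (j = k)) s) ^^ (C 0).eval (bxor (fun j => decide (j = k)) y) ^^ (C 0).eval (bxor (fun j => decide (j = k)) (bxor s y)))) ∈ S) ∧ (∀ s ∈ U, ∃ ℓ ∈ S, ∀ r : Fin (m + m) → Bool, (∀ y z : Fin (m + m) → Bool, (((C 0).eval z ^^ (C 0).eval (bxor z s) ^^ (C 0).eval (bxor z r) ^^ (C 0).eval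 (bxor z (bxor s r))) ^^ ((C 0).eval (bxor z y) ^^ (C 0).eval (bxor (bxor z y) s) ^^ (C 0).eval (bxor (bxor z y) r) ^^ (C 0).eval (bxor (bxor z y) (bxor s r)))) = false) → ((C 0).eval r ^^ (C 0).eval (bxor r s) ^^ (C 0).eval zeroVec ^^ (C 0).eval s) = ((Finset.univ.filter fun i => ℓ i && r i).card).bodd)) →
          (∀ s ∈ S, ∀ u ∈ U, ((Finset.univ.filter fun i => s i && u i).card).bodd = false) →
          S.card < 2 ^ m → U.card < 2 ^ m →
          (∃ r : ℕ, r ≤ m + m + 1 ∧ (2 : ℝ) ^ ((m + m) * r) / ((m + m + 2 : ℝ) ^ 8) ≤ (∑ xs : Fin (r) → (Fin (m + m) → Bool), (((@Finset.filter (Fin (m + m) → Bool) (fun v => v ∉ S ∧ (∃ V : Finset (Fin (m + m) → Bool), ((zeroVec ∈ V ∧ ∀ x ∈ V, ∀ y ∈ V, bxor x y ∈ V) ∧ (((V).card : ℝ) ^ 2 = (2 : ℝ) ^ (m + m)) ∧ ∀ u ∈ V, ∀ v ∈ V, ∀ x, ((C 1).eval x ^^ (C 1).eval (bxor x u) ^^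 (C 1).eval (bxor x v) ^^ (C 1).eval (bxor x (bxor u v))) = false) ∧ S ⊆ V ∧ v ∈ V ∧ (∀ s ∈ V, ∀ u ∈ U, ((Finset.univ.filter fun i => s i && u i).card).bodd = false))) (Classical.decPred _) (Finset.univ.filter fun (v : Fin (m + m) → Bool) => (∀ s ∈ S, ∀ x, ((C 1).eval x ^^ (C 1).eval (bxor x s) ^^ (C 1).eval (bxor x v) ^^ (C 1).eval (bxor x (bxor s v))) = false) ∧ (∀ u ∈ U, ((Finset.univ.filter fun i => u i && v i).card).bodd = false) ∧ ∀ j, (∀ y z : Fin (m + m) → Bool, (((C 1).eval z ^^ (C 1).eval (bxor z (xs j)) ^^ (C 1).eval (bxor z v) ^^ (C 1).eval (bxor z (bxor (xs j) v))) ^^ ((C 1).eval (bxor z y) ^^ (C 1).eval (bxor (bxor z y) (xs j)) ^^ (C 1).eval (bxor (bxor z y) v) ^^ (C 1).eval (bxor (bxor z y) (bxor (xs j) v)))) = false))).card : ℝ) / (((Finset.univ.filter fun (v : Fin (m + m) → Bool) => (∀ s ∈ S, ∀ x, ((C 1).eval x ^^ (C 1).eval (bxor x s) ^^ (C 1).eval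 (bxor x v) ^^ (C 1).eval (bxor x (bxor s v))) = false) ∧ (∀ u ∈ U, ((Finset.univ.filter fun i => u i && v i).card).bodd = false) ∧ ∀ j, (∀ y z : Fin (m + m) → Bool, (((C 1).eval z ^^ (C 1).eval (bxor z (xs j)) ^^ (C 1).eval (bxor z v) ^^ (C 1).eval (bxor z (bxor (xs j) v))) ^^ ((C 1).eval (bxor z y) ^^ (C 1).eval (bxor (bxor z y) (xs j)) ^^ (C 1).eval (bxor (bxor z y) v) ^^ (C 1).eval (bxor (bxor z y) (bxor (xs j) v)))) = false))).card : ℝ)))) ∨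
          (∃ r : ℕ, r ≤ m + m + 1 ∧ (2 : ℝ) ^ ((m + m) * r) / ((m + m + 2 : ℝ) ^ 8) ≤ (∑ xs : Fin (r) → (Fin (m + m) → Bool), (((@Finset.filter (Fin (m + m) → Bool) (fun v => v ∉ U ∧ (∃ V : Finset (Fin (m + m) → Bool), ((zeroVec ∈ V ∧ ∀ x ∈ V, ∀ y ∈ V, bxor x y ∈ V) ∧ (((V).card : ℝ) ^ 2 = (2 : ℝ) ^ (m + m)) ∧ ∀ u ∈ V, ∀ v ∈ V, ∀ x, ((C 0).eval x ^^ (C 0).eval (bxor x u) ^^ (C 0).eval (bxor x v) ^^ (C 0).eval (bxor x (bxor u v))) = false) ∧ U ⊆ V ∧ v ∈ V ∧ (∀ s ∈ V, ∀ u ∈ S, ((Finset.univ.filter fun i => s i && u i).card).bodd = false))) (Classical.decPred _) (Finset.univ.filter fun (v : Fin (m + m) → Bool) => (∀ s ∈ U, ∀ x, ((C 0).eval x ^^ (C 0).eval (bxor x s) ^^ (C 0).eval (bxor x v) ^^ (C 0).eval (bxor x (bxor s v))) = false) ∧ (∀ u ∈ S, ((Finset.univ.filter fun i => u i && v i).card).bodd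 = false) ∧ ∀ j, (∀ y z : Fin (m + m) → Bool, (((C 0).eval z ^^ (C 0).eval (bxor z (xs j)) ^^ (C 0).eval (bxor z v) ^^ (C 0).eval (bxor z (bxor (xs j) v))) ^^ ((C 0).eval (bxor z y) ^^ (C 0).eval (bxor (bxor z y) (xs j)) ^^ (C 0).eval (bxor (bxor z y) v) ^^ (C 0).eval (bxor (bxor z y) (bxor (xs j) v)))) = false))).card : ℝ) / (((Finset.univ.filter fun (v : Fin (m + m) → Bool) => (∀ s ∈ U, ∀ x, ((C 0).eval x ^^ (C 0).eval (bxor x s) ^^ (C 0).eval (bxor x v) ^^ (C 0).eval (bxor x (bxor s v))) = false) ∧ (∀ u ∈ S, ((Finset.univ.filter fun i => u i && v i).card).bodd = false) ∧ ∀ j, (∀ y z : Fin (m + m) → Bool, (((C 0).eval z ^^ (C 0).eval (bxor z (xs j)) ^^ (C 0).eval (bxor z v) ^^ (C 0).eval (bxor z (bxor (xs j) v))) ^^ ((C 0).eval (bxor z y) ^^ (C 0).eval (bxor (bxor z y) (xs j)) ^^ (C 0).eval (bxor (bxor z y) v) ^^ (C 0).eval (bxor (bxor z y) (bxor (xs j)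 v)))) = false))).card : ℝ)))) := by
  intro m hm C hB hdeg hΦ horb S U hS hU hcb hca ho hSlt hUlt
  left
  refine ⟨0, Nat.zero_le _, ?_⟩
  -- the no-trap extension of the pair
  obtain ⟨V, hV, hSV, hVU⟩ :=
    stub_noTrapTransport stub_noTrapTemplate m (C 0).eval (C 1).eval (hdeg 0) (hdeg 1) hΦ horb S U hS hU hcb hca ho
  have hVflat := hV.2.2
  have hcard : (V.card : ℝ) ^ 2 = (2 : ℝ) ^ (m + m) := hV.2.1
  have hVc : V.card = 2 ^ m := by
    have h2 : (2 : ℝ) ^ (m + m) = ((2 : ℝ) ^ m) ^ 2 := by rw [← pow_mul]; ring_nf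
    rw [h2] at hcard
    have hn : (0 : ℝ) ≤ V.card := by positivity
    have hp : (0 : ℝ) ≤ (2 : ℝ) ^ m := by positivity
    have := (pow_left_inj₀ hn hp two_ne_zero).1 hcard
    exact_mod_cast this
  have hne : ¬ V ⊆ S := fun h => by
    have := Finset.card_le_card h
    omega
  obtain ⟨v, hvV, hvS⟩ := Finset.not_subset.1 hne
  -- one term in the sum over `Fin 0 → _`, and `2 ^ ((m+m) * 0) = 1`
  rw [Fintype.sum_unique, Nat.mul_zero, pow_zero]
  refine one_div_le_card_filter_div_card _ _ _ v ?_ ⟨hvS, V, hV, hSV, hvV, hVU⟩ _ ?_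
  · -- `v ∈ K(∅) = Z_b(S) ∩ U^⊥` (no probe clause)
    refine Finset.mem_filter.2 ⟨Finset.mem_univ _, fun s hs x => hVflat s (hSV hs) v hvV x, fun u hu => ?_, fun j => j.elim0⟩
    have h := hVU v hvV u hu
    have hfe : (Finset.univ.filter fun i => u i && v i) = (Finset.univ.filter fun i => v i && u i) := by
      congr 1; funext i; rw [Bool.and_comm]
    rw [hfe]; exact h
  · -- `|𝔽₂^{2m}| = 2^{2m} ≤ (2m+2)^8`
    have hc : (Fintype.card (Fin (m + m) → Bool) : ℝ) = (2 : ℝ) ^ (m + m) := by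
      rw [Fintype.card_fun, Fintype.card_bool, Fintype.card_fin]; push_cast; ring
    rw [hc]
    exact two_pow_two_mul_le_pow_eight hm

end Summit.QuantumAdvantage.QuantumAdvantage.Theorems.SignedExactCubicForrelationNotPrBPP

end
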